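import Mathlib.Algebra.Lie.Sl2
import Mathlib.Algebra.Lie.InvariantForm
import Mathlib.LinearAlgebra.Eigenspace.Triangularizable
import Mathlib.LinearAlgebra.QuadraticForm.Basic
import HarnessLib

/-!
# A three-dimensional centre-free Lie algebra with a non-degenerate invariant symmetric form is `𝔰𝔩₂`

Topic `Literature/Algebra/Lie`. Theorems only (no definition, no named fact, D-0026), Mathlib vocabulary (`IsSl2Triple`,
`LinearMap.BilinForm.lieInvariant`, `LinearMap.BilinForm.Nondegenerate`). Written for the cell `pub-hodgecm2` (COR-CM),
seat `b27`, count-neutral own lane MT-RANK-SEVEN-TYPEIII: the compact factor `𝔨` of the complexified Hodge Lie algebra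
in the type-III position is a three-dimensional centre-free Lie algebra of operators carrying the (non-degenerate,
invariant, symmetric) trace form of `H¹(X, ℂ)`; this file produces an `sl₂`-triple spanning it.

PRINTED RESULT. Over an algebraically closed field of characteristic `0` every three-dimensional simple Lie algebra is
isomorphic to `𝔰𝔩₂` (N. Jacobson, *Lie Algebras* (1962), Ch. I §4, the classification of Lie algebras of dimension
`≤ 3`; J. E. Humphreys, GTM 9, §8.3 with §7). A three-dimensional Lie algebra with trivial centre and a non-degenerate
invariant symmetric bilinear form is such (it is semisimple by Dieudonné's criterion, Mathlib
`LieAlgebra.InvariantForm.isSemisimple_of_nondegenerate`, and of dimension `3`). THIS FILE gives the direct construction,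
avoiding root systems:

* `exists_apply_self_ne_zero` — some `x` has `B x x ≠ 0` (polarisation).
* For such `x`, `ad x` is not nilpotent (`lie_eq_zero_of_lie_lie_eq_zero`: a vector `w = ⁅x, u⁆ ≠ 0` with `⁅x, w⁆ = 0`
  would be `B`-orthogonal to the basis `x, u, w`), so over an algebraically closed field `ad x` has an eigenvector `e`
  with a NON-ZERO eigenvalue `λ` (`exists_lie_eq_smul`); then `B e e = B e x = 0`, the plane `x^⊥` contains an isotropic `f` with `B e f = 1`,
  `B f x = 0`, and testing against the basis `x, e, f` gives `⁅x, f⁆ = −λ f`, `⁅e, f⁆ = (λ / B x x) x`.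
* **`exists_isSl2Triple_of_finrank_eq_three`** — rescaling (`h = (2/λ) x`, `e' = (2 B x x / λ²) e`): an `sl₂`-triple
  `(h, e', f)` with `L = k h ⊕ k e' ⊕ k f` (every `y` is `a h + b e' + c f`).

## References

* [Jacobson1962LieAlgebras] N. Jacobson, *Lie Algebras* (1962), Ch. I §4 (Lie algebras of dimension `≤ 3`), Ch. III §8.
* [Humphreys1972] J. E. Humphreys, *Introduction to Lie Algebras and Representation Theory*, GTM 9 (1972), §7.1, §8.3.
-/

namespace Literature.Algebra.Lie

namespace Sl2OfDimThree

open Module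
open LinearMap (BilinForm)

variable {k : Type*} [Field k] [CharZero k]
variable {L : Type*} [LieRing L] [LieAlgebra k L]

/-! ## §1 Elementary consequences of invariance -/

section Invariance

variable {B : BilinForm k L}

omit [CharZero k] in
/-- `B ⁅x, y⁆ x = 0`. [cite: Humphreys1972, §6.2 (associativity of invariant forms)] -/
theorem apply_lie_self (hBi : B.lieInvariant L) (x y : L) : B ⁅x, y⁆ x = 0 := by
  rw [hBi, lie_self, map_zero, neg_zero]

omit [CharZero k] in
/-- `B x ⁅x, y⁆ = 0`. [cite: Humphreys1972, §6.2 (associativity of invariant forms)] -/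
theorem apply_self_lie (hBs : B.IsSymm) (hBi : B.lieInvariant L) (x y : L) : B x ⁅x, y⁆ = 0 := by
  rw [hBs.eq, apply_lie_self hBi]

/-- `B ⁅x, y⁆ y = 0` (symmetric invariant form, characteristic `≠ 2`). [cite: Humphreys1972, §6.2] -/
theorem apply_lie_right_self (hBs : B.IsSymm) (hBi : B.lieInvariant L) (x y : L) : B ⁅x, y⁆ y = 0 := by
  have h1 : B ⁅x, y⁆ y = -B y ⁅x, y⁆ := hBi x y y
  rw [hBs.eq y] at h1
  have h2 : (2 : k) * B ⁅x, y⁆ y = 0 := by rw [two_mul]; nth_rw 1 [h1]; rw [neg_add_cancel]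
  exact (mul_eq_zero.1 h2).resolve_left two_ne_zero

/-- An eigenvector of `ad x` with non-zero eigenvalue is isotropic: `⁅x, e⁆ = λ e`, `λ ≠ 0` ⟹ `B e e = 0`.
[cite: Humphreys1972, §8.1 (Prop., orthogonality of root spaces)] -/
theorem apply_self_eq_zero_of_lie_eq_smul (hBs : B.IsSymm) (hBi : B.lieInvariant L) {x e : L} {lam : k}
    (hlam : lam ≠ 0) (he : ⁅x, e⁆ = lam • e) : B e e = 0 := by
  have h1 : B ⁅x, e⁆ e = 0 := apply_lie_right_self hBs hBi x e
  rw [he, map_smul, LinearMap.smul_apply, smul_eq_mul] at h1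
  exact (mul_eq_zero.1 h1).resolve_left hlam

omit [CharZero k] in
/-- `⁅x, e⁆ = λ e`, `λ ≠ 0` ⟹ `B e x = 0`. [cite: Humphreys1972, §8.1] -/
theorem apply_eq_zero_of_lie_eq_smul (hBi : B.lieInvariant L) {x e : L} {lam : k} (hlam : lam ≠ 0)
    (he : ⁅x, e⁆ = lam • e) : B e x = 0 := by
  have h1 : B ⁅x, e⁆ x = 0 := apply_lie_self hBi x e
  rw [he, map_smul, LinearMap.smul_apply, smul_eq_mul] at h1
  exact (mul_eq_zero.1 h1).resolve_left hlam

end Invariance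

/-! ## §2 A non-isotropic vector, and three-vector bases -/

/-- **Some `x` has `B x x ≠ 0`** for a non-degenerate symmetric form on a non-zero space (polarisation; Mathlib
`exists_bilinForm_self_ne_zero`). [folklore] -/
private theorem exists_apply_self_ne_zero [Nontrivial L] {B : BilinForm k L} (hBs : B.IsSymm) (hBn : B.Nondegenerate) :
    ∃ x : L, B x x ≠ 0 :=
  haveI : Invertible (2 : k) := invertibleOfNonzero two_ne_zero
  LinearMap.BilinForm.exists_bilinForm_self_ne_zero hBn.ne_zero (LinearMap.BilinForm.isSymm_iff.1 hBs)

variable [FiniteDimensional k L]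

omit [CharZero k] in
/-- Three linearly independent vectors of a three-dimensional space span it: every `y` is a combination. [folklore] -/
private theorem exists_repr_of_linearIndependent (h3 : finrank k L = 3) {v : Fin 3 → L} (hv : LinearIndependent k v)
    (y : L) : ∃ a b c : k, y = a • v 0 + b • v 1 + c • v 2 := by
  have htop : Submodule.span k (Set.range v) = ⊤ :=
    hv.span_eq_top_of_card_eq_finrank' (by rw [Fintype.card_fin, h3])
  have hy : y ∈ Submodule.span k (Set.range v) := by rw [htop]; exact Submodule.mem_top
  obtain ⟨c, hc⟩ := (Submodule.mem_span_range_iff_exists_fun k).1 hy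
  refine ⟨c 0, c 1, c 2, ?_⟩
  rw [← hc, Fin.sum_univ_three]

omit [CharZero k] in
/-- A vector `B`-orthogonal to three linearly independent vectors of a three-dimensional space vanishes (non-degenerate
`B`). [folklore] -/
private theorem eq_zero_of_orthogonal_three (h3 : finrank k L = 3) {B : BilinForm k L} (hBn : B.Nondegenerate)
    {v : Fin 3 → L} (hv : LinearIndependent k v) {w : L} (h0 : B w (v 0) = 0) (h1 : B w (v 1) = 0)
    (h2 : B w (v 2) = 0) : w = 0 := by
  refine hBn.1 w fun y => ?_
  obtain ⟨a, b, c, rfl⟩ := exists_repr_of_linearIndependent h3 hv y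
  simp only [map_add, map_smul, smul_eq_mul, h0, h1, h2, mul_zero, add_zero]

omit [CharZero k] [FiniteDimensional k L] in
/-- Linear independence of three vectors from a vanishing test. [folklore] -/
private theorem linearIndependent_three {x y z : L}
    (h : ∀ a b c : k, a • x + b • y + c • z = 0 → a = 0 ∧ b = 0 ∧ c = 0) :
    LinearIndependent k ![x, y, z] := by
  rw [Fintype.linearIndependent_iff]
  intro g hg i
  rw [Fin.sum_univ_three] at hg
  simp only [Matrix.cons_val_zero, Matrix.cons_val_one, Matrix.cons_val] at hg
  obtain ⟨h0, h1, h2⟩ := h (g 0) (g 1) (g 2) hg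
  fin_cases i
  · exact h0
  · exact h1
  · exact h2

/-! ## §3 `ad x` is not nilpotent for a non-isotropic `x` -/

/-- **If `B x x ≠ 0` then no `u` has `w = ⁅x, u⁆ ≠ 0` with `⁅x, w⁆ = 0`** (centre-free is not even needed here): such a
`w` satisfies `B w x = B w u = B w w = 0`, and `x, u, w` are linearly independent (apply `ad x` and pair with `x`), so
`w` is `B`-orthogonal to everything. [cite: Jacobson1962LieAlgebras, Ch. I §4] -/
theorem lie_eq_zero_of_lie_lie_eq_zero (h3 : finrank k L = 3) {B : BilinForm k L} (hBs : B.IsSymm)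
    (hBn : B.Nondegenerate) (hBi : B.lieInvariant L) {x : L} (hx : B x x ≠ 0) {u : L} (hw : ⁅x, ⁅x, u⁆⁆ = 0) :
    ⁅x, u⁆ = 0 := by
  by_contra hne
  set w := ⁅x, u⁆ with hwdef
  have hwx : B w x = 0 := apply_lie_self hBi x u
  have hwu : B w u = 0 := apply_lie_right_self hBs hBi x u
  have hww : B w w = 0 := by
    have h := hBi x u w
    rw [← hwdef, hw, map_zero, neg_zero] at h
    exact h
  have hli : LinearIndependent k ![x, u, w] := by
    refine linearIndependent_three fun a b c habc => ?_
    -- apply `ad x`: `b w = 0`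
    have h1 : b • w = 0 := by
      have h := congrArg (fun y => ⁅x, y⁆) habc
      simp only [lie_add, lie_smul, lie_self, smul_zero, zero_add, lie_zero, ← hwdef, hw, add_zero] at h
      exact h
    have hb : b = 0 := (smul_eq_zero.1 h1).resolve_right hne
    rw [hb, zero_smul, add_zero] at habc
    -- pair with `x`: `a B x x = 0`
    have h2 : a * B x x = 0 := by
      have h := congrArg (fun y => B y x) habc
      simp only [map_add, map_smul, LinearMap.add_apply, LinearMap.smul_apply, smul_eq_mul, hwx, mul_zero, add_zero,
        map_zero, LinearMap.zero_apply] at h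
      exact h
    have ha : a = 0 := (mul_eq_zero.1 h2).resolve_right hx
    rw [ha, zero_smul, zero_add] at habc
    exact ⟨ha, hb, (smul_eq_zero.1 habc).resolve_right hne⟩
  have h0 : w = 0 := eq_zero_of_orthogonal_three h3 hBn hli (by simpa using hwx) (by simpa using hwu)
    (by simpa using hww)
  exact hne h0

/-- **`ad x` has a non-zero eigenvalue** (`B x x ≠ 0`, `x` not central, `k` algebraically closed): otherwise the
generalised `0`-eigenspace of `ad x` is everything, i.e. `ad x` is nilpotent, and the last non-zero term of an orbit
`u, ⁅x,u⁆, ⁅x,⁅x,u⁆⁆, …` contradicts `lie_eq_zero_of_lie_lie_eq_zero`. [cite: Jacobson1962LieAlgebras, Ch. I §4]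
[cite: Humphreys1972, §8.3] -/
theorem exists_lie_eq_smul [IsAlgClosed k] (h3 : finrank k L = 3) {B : BilinForm k L} (hBs : B.IsSymm)
    (hBn : B.Nondegenerate) (hBi : B.lieInvariant L) {x : L} (hx : B x x ≠ 0) (hxc : ∃ y : L, ⁅x, y⁆ ≠ 0) :
    ∃ (lam : k) (e : L), lam ≠ 0 ∧ e ≠ 0 ∧ ⁅x, e⁆ = lam • e := by
  set D : Module.End k L := LieAlgebra.ad k L x with hD
  have hDapply : ∀ y, D y = ⁅x, y⁆ := fun y => LieAlgebra.ad_apply k L x y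
  by_cases hex : ∃ μ : k, μ ≠ 0 ∧ D.maxGenEigenspace μ ≠ ⊥
  · obtain ⟨μ, hμ, hne⟩ := hex
    have hev : D.HasEigenvalue μ :=
      (Module.End.hasUnifEigenvalue_iff_hasUnifEigenvalue_one (f := D) (μ := μ) (k := ⊤) (by simp)).1 hne
    obtain ⟨e, he⟩ := hev.exists_hasEigenvector
    exact ⟨μ, e, hμ, he.2, by rw [← hDapply]; exact he.apply_eq_smul⟩
  · exfalso
    push Not at hex
    -- every vector is in the generalised `0`-eigenspace: `ad x` is nilpotent on each vector
    have htop : D.maxGenEigenspace 0 = ⊤ := by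
      refine le_antisymm le_top ?_
      rw [← Module.End.iSup_maxGenEigenspace_eq_top D]
      refine iSup_le fun μ => ?_
      by_cases hμ : μ = 0
      · rw [hμ]
      · rw [hex μ hμ]; exact bot_le
    have hnil : ∀ y : L, ∃ n : ℕ, (D ^ n) y = 0 := fun y => by
      have hy : y ∈ D.maxGenEigenspace 0 := by rw [htop]; exact Submodule.mem_top
      rw [Module.End.mem_maxGenEigenspace] at hy
      simpa only [zero_smul, sub_zero] using hy
    obtain ⟨y, hy⟩ := hxc
    classical
    obtain ⟨n, hn⟩ := hnil y
    -- the least `m` with `D^m y = 0` is `≥ 2`; its predecessor gives `w = D^{m-1} y ≠ 0`, `D w = 0`, `w = ⁅x, D^{m-2} y⁆`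
    have hexm : ∃ m : ℕ, (D ^ m) y = 0 := ⟨n, hn⟩
    let m := Nat.find hexm
    have hm : (D ^ m) y = 0 := Nat.find_spec hexm
    have hm0 : m ≠ 0 := by
      intro h0
      have h := hm
      rw [h0, pow_zero, Module.End.one_apply] at h
      rw [h, lie_zero] at hy
      exact hy rfl
    have hm1 : m ≠ 1 := by
      intro h1
      have h := hm
      rw [h1, pow_one, hDapply] at h
      exact hy h
    obtain ⟨j, hj⟩ : ∃ j, m = j + 2 := ⟨m - 2, by omega⟩
    have hjlt : j + 1 < m := by omega
    have hne : (D ^ (j + 1)) y ≠ 0 := Nat.find_min hexm hjlt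
    have hzero : ⁅x, ⁅x, (D ^ j) y⁆⁆ = 0 := by
      have h := hm
      rw [hj, pow_succ', pow_succ', Module.End.mul_apply, Module.End.mul_apply, hDapply, hDapply] at h
      exact h
    have h := lie_eq_zero_of_lie_lie_eq_zero h3 hBs hBn hBi hx hzero
    apply hne
    rw [pow_succ', Module.End.mul_apply, hDapply, h]

/-! ## §4 The `sl₂`-triple -/

/-- **A three-dimensional Lie algebra over an algebraically closed field of characteristic `0` with trivial centre and
a non-degenerate invariant symmetric bilinear form is spanned by an `sl₂`-triple**: there are `h, e, f` with
`⁅h, e⁆ = 2e`, `⁅h, f⁆ = −2f`, `⁅e, f⁆ = h ≠ 0`, and every element is `a h + b e + c f`.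
[cite: Jacobson1962LieAlgebras, Ch. I §4] [cite: Humphreys1972, §8.3] -/
theorem exists_isSl2Triple_of_finrank_eq_three [IsAlgClosed k] (h3 : finrank k L = 3) {B : BilinForm k L}
    (hBs : B.IsSymm) (hBn : B.Nondegenerate) (hBi : B.lieInvariant L)
    (hz : ∀ x : L, (∀ y : L, ⁅x, y⁆ = 0) → x = 0) :
    ∃ h e f : L, IsSl2Triple h e f ∧ ∀ y : L, ∃ a b c : k, y = a • h + b • e + c • f := by
  haveI : Nontrivial L := Module.nontrivial_of_finrank_pos (R := k) (by rw [h3]; norm_num)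
  obtain ⟨x, hx⟩ := exists_apply_self_ne_zero hBs hBn
  have hx0 : x ≠ 0 := by rintro rfl; exact hx (by simp)
  have hxc : ∃ y : L, ⁅x, y⁆ ≠ 0 := by
    by_contra h
    push Not at h
    exact hx0 (hz x h)
  obtain ⟨lam, e, hlam, he0, he⟩ := exists_lie_eq_smul h3 hBs hBn hBi hx hxc
  have hee : B e e = 0 := apply_self_eq_zero_of_lie_eq_smul hBs hBi hlam he
  have hex : B e x = 0 := apply_eq_zero_of_lie_eq_smul hBi hlam he
  -- an isotropic partner `f ∈ x^⊥` with `B e f = 1`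
  obtain ⟨f, hef, hfx, hff⟩ : ∃ f : L, B e f = 1 ∧ B f x = 0 ∧ B f f = 0 := by
    obtain ⟨f₀, hf₀⟩ : ∃ f₀, B e f₀ ≠ 0 := by
      by_contra h
      push Not at h
      exact he0 (hBn.1 e h)
    -- project to `x^⊥`, normalise, make isotropic
    obtain ⟨f₁, hf₁⟩ : ∃ f₁ : L, f₁ = f₀ - (B f₀ x * (B x x)⁻¹) • x := ⟨_, rfl⟩
    have hf₁x : B f₁ x = 0 := by
      rw [hf₁, map_sub, map_smul, LinearMap.sub_apply, LinearMap.smul_apply, smul_eq_mul, mul_assoc,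
        inv_mul_cancel₀ hx, mul_one, sub_self]
    have hef₁ : B e f₁ = B e f₀ := by
      rw [hf₁, map_sub, map_smul, smul_eq_mul, hex, mul_zero, sub_zero]
    obtain ⟨f₂, hf₂⟩ : ∃ f₂ : L, f₂ = (B e f₀)⁻¹ • f₁ := ⟨_, rfl⟩
    have hef₂ : B e f₂ = 1 := by rw [hf₂, map_smul, smul_eq_mul, hef₁, inv_mul_cancel₀ hf₀]
    have hf₂x : B f₂ x = 0 := by rw [hf₂, map_smul, LinearMap.smul_apply, smul_eq_mul, hf₁x, mul_zero]
    refine ⟨f₂ - ((2 : k)⁻¹ * B f₂ f₂) • e, ?_, ?_, ?_⟩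
    · rw [map_sub, map_smul, smul_eq_mul, hef₂, hee, mul_zero, sub_zero]
    · rw [map_sub, map_smul, LinearMap.sub_apply, LinearMap.smul_apply, smul_eq_mul, hf₂x, hex, mul_zero, sub_zero]
    · have hfe : B f₂ e = 1 := by rw [hBs.eq, hef₂]
      simp only [map_sub, map_smul, LinearMap.sub_apply, LinearMap.smul_apply, smul_eq_mul, hef₂, hfe, hee]
      have h2 : (2 : k)⁻¹ + (2 : k)⁻¹ = 1 := by rw [← two_mul, mul_inv_cancel₀ two_ne_zero]
      linear_combination (-(B f₂ f₂)) * h2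
  have hfe : B f e = 1 := by rw [hBs.eq, hef]
  have hxe : B x e = 0 := by rw [hBs.eq, hex]
  have hxf : B x f = 0 := by rw [hBs.eq, hfx]
  -- `x, e, f` are linearly independent
  have hli : LinearIndependent k ![x, e, f] := by
    refine linearIndependent_three fun a b c habc => ?_
    have ha : a = 0 := by
      have h := congrArg (fun y => B y x) habc
      simp only [map_add, map_smul, LinearMap.add_apply, LinearMap.smul_apply, smul_eq_mul, hex, hfx, mul_zero,
        add_zero, map_zero, LinearMap.zero_apply] at h
      exact (mul_eq_zero.1 h).resolve_right hx
    have hc : c = 0 := by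
      have h := congrArg (fun y => B y e) habc
      simp only [map_add, map_smul, LinearMap.add_apply, LinearMap.smul_apply, smul_eq_mul, hxe, hee, hfe, mul_zero,
        zero_add, mul_one, map_zero, LinearMap.zero_apply] at h
      exact h
    have hb : b = 0 := by
      have h := congrArg (fun y => B y f) habc
      simp only [map_add, map_smul, LinearMap.add_apply, LinearMap.smul_apply, smul_eq_mul, hxf, hef, hff, mul_zero,
        zero_add, add_zero, mul_one, map_zero, LinearMap.zero_apply] at h
      exact h
    exact ⟨ha, hb, hc⟩
  -- `⁅x, f⁆ = −λ f`
  have hxfl : ⁅x, f⁆ = -lam • f := by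
    have h0 : ⁅x, f⁆ + lam • f = 0 := by
      refine eq_zero_of_orthogonal_three h3 hBn hli ?_ ?_ ?_
      · simp only [Matrix.cons_val_zero, map_add, map_smul, LinearMap.add_apply, LinearMap.smul_apply, smul_eq_mul,
          apply_lie_self hBi, hfx, mul_zero, add_zero]
      · simp only [Matrix.cons_val_one, Matrix.cons_val_zero, map_add, map_smul, LinearMap.add_apply,
          LinearMap.smul_apply, smul_eq_mul, hfe, mul_one]
        rw [hBi x f e, he, map_smul, smul_eq_mul, hfe, mul_one, neg_add_cancel]
      · simp only [Matrix.cons_val, map_add, map_smul, LinearMap.add_apply, LinearMap.smul_apply, smul_eq_mul, hff,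
          mul_zero, add_zero, apply_lie_right_self hBs hBi]
    rw [neg_smul]
    exact eq_neg_of_add_eq_zero_left h0
  -- `⁅e, f⁆ = (λ / B x x) x`
  have hefx : ⁅e, f⁆ = ((B x x)⁻¹ * lam) • x := by
    have h0 : ⁅e, f⁆ - ((B x x)⁻¹ * lam) • x = 0 := by
      refine eq_zero_of_orthogonal_three h3 hBn hli ?_ ?_ ?_
      · simp only [Matrix.cons_val_zero, map_sub, map_smul, LinearMap.sub_apply, LinearMap.smul_apply, smul_eq_mul]
        rw [hBi e f x, ← lie_skew e x, he, map_neg, map_smul, smul_eq_mul, hfe, mul_one, neg_neg, mul_comm ((B x x)⁻¹) lam,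
          mul_assoc, inv_mul_cancel₀ hx, mul_one, sub_self]
      · simp only [Matrix.cons_val_one, Matrix.cons_val_zero, map_sub, map_smul, LinearMap.sub_apply,
          LinearMap.smul_apply, smul_eq_mul, hxe, mul_zero, sub_zero, apply_lie_self hBi]
      · simp only [Matrix.cons_val, map_sub, map_smul, LinearMap.sub_apply, LinearMap.smul_apply, smul_eq_mul, hxf,
          mul_zero, sub_zero, apply_lie_right_self hBs hBi]
    rwa [sub_eq_zero] at h0
  -- rescale: `h = (2/λ) x`, `e' = (2 B x x / λ²) e`
  refine ⟨((2 : k) * lam⁻¹) • x, ((2 : k) * B x x * (lam⁻¹ * lam⁻¹)) • e, f, ⟨?_, ?_, ?_, ?_⟩, ?_⟩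
  · exact smul_ne_zero (mul_ne_zero two_ne_zero (inv_ne_zero hlam)) hx0
  · rw [smul_lie, hefx, smul_smul]
    congr 1
    field_simp
  · rw [smul_lie, lie_smul, he, smul_smul, smul_smul, two_nsmul, ← two_smul k, smul_smul]
    congr 1
    field_simp
  · rw [smul_lie, hxfl, smul_smul, two_nsmul, ← two_smul k, ← neg_smul]
    congr 1
    field_simp
  · intro y
    obtain ⟨a, b, c, hy⟩ := exists_repr_of_linearIndependent h3 hli y
    simp only [Matrix.cons_val_zero, Matrix.cons_val_one, Matrix.cons_val] at hy
    refine ⟨a * (lam * (2 : k)⁻¹), b * (lam * lam * ((2 : k)⁻¹ * (B x x)⁻¹)), c, ?_⟩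
    rw [hy, smul_smul, smul_smul]
    congr 2
    · congr 1
      field_simp
    · congr 1
      field_simp

end Sl2OfDimThree

end Literature.Algebra.Lie
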